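import Summits.HodgeConjecture.CorCM.Model.ExteriorAlgebraFacts
import Summits.HodgeConjecture.CorCM.Model.PerLConeFacts
import HarnessLib

/-!
# COR-CM — model row M17 `weilLine_rank` for `Model.universeOf`, unconditional

HONEST FRAMING (cell pub-hodgecm2 / COR-CM): structural Betti-cohomology fact; nothing about algebraic cycles.
Plugs the model's `H¹`-facts M13 `universeOf_fact_eigenLine` and M07 `universeOf_fact_H1_rank`
(`CorCM/Model/PerLConeFacts.lean`, model-2) into `universeOf_fact_weilLine_rank_of`
(`CorCM/Model/ExteriorAlgebraFacts.lean`, p2): the Weil line of every corner product of the model has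
`ℚ`-dimension `[K:ℚ]`.
-/

noncomputable section

open Literature.AlgebraicGeometry.HodgeTheory
open Literature.NumberTheory.Automorphic.PicardCM

namespace Summit.HodgeConjecture.CorCM.Model

/-- **Row M17 (`weilLine_rank`, package M15) for the model universe, unconditionally**: for every CM field `K`
and corner product `P` of `Model.universeOf`, `dim_ℚ W_K(P) = [K:ℚ]`. [folklore] -/
theorem universeOf_fact_weilLine_rank (hHD : exists_isReal_hodgeModel) (hI : hodgePQ_independent_of_hodgeModel)
    (hU : Literature.NumberTheory.Automorphic.PicardCM.BallQuotientUniformisedDatum)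
    (h₃ : Literature.NumberTheory.Automorphic.PicardCM.CMAbelianVarietyRealised) :
    (universeOf hHD hI hU h₃).Fact_weilLine_rank :=
  universeOf_fact_weilLine_rank_of hHD hI hU h₃ (universeOf_fact_eigenLine hHD hI hU h₃)
    (universeOf_fact_H1_rank hHD hI hU h₃)

end Summit.HodgeConjecture.CorCM.Model

end
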